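/-
Copyright (c) 2026. All rights reserved.
Released under Apache 2.0 license as described in the file LICENSE.
-/
import Literature.NumberTheory.PAdicHodge.FontainePstKroneckerSchemata
import Literature.NumberTheory.PAdicHodge.DeRhamFilteredComparison
import Literature.NumberTheory.GaloisRepresentations.LabelledWeightsKronecker
import Literature.NumberTheory.GaloisRepresentations.LabelledWeightsCoeffBaseChange
import Literature.NumberTheory.GaloisRepresentations.LabelledWeightsDeRhamRank
import Literature.NumberTheory.GaloisRepresentations.PstWeilDeligneTwistDeRham
import HarnessLib

/-!
# `KroneckerLabelledWeightsSchema` holds: `HT_τ(ρ₁ ⊗ ρ₂) = HT_τ(ρ₁) + HT_τ(ρ₂)` for THE pinned datum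

We discharge the named fact `Literature.NumberTheory.PAdicHodge.KroneckerLabelledWeightsSchema`
(`FontainePstKroneckerSchemata`): for an `ℓ`-adic local field `K`, framed
`ρ₁ : Γ_K → GL_n(ℚ̄_ℓ)`, `ρ₂ : Γ_K → GL_m(ℚ̄_ℓ)` de Rham for `fontainePst K ℓ hK`, their Kronecker
product `ρ : Γ_K → GL_k(ℚ̄_ℓ)` in the product basis enumerated by `e : Fin n × Fin m ≃ Fin k`, and a
`ℚ_ℓ`-label `τ : K → ℚ̄_ℓ`, the labelled Hodge–Tate weights of `ρ` are the pairwise sums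
`{a + b : a ∈ HT_τ(ρ₁), b ∈ HT_τ(ρ₂)}` (`KroneckerLabelledWeightsSchema_holds`).

## Proof

* `FramedRep.exists_kron`: the Kronecker product of two framed representations in the product basis
  exists as a framed (continuous) representation; `HasQlModel.kron`: Kronecker products of models are
  models of the Kronecker product (conjugate by `P₁ ⊗ₖ P₂`).
* `labelledHodgeTateWeights_kron_of_eq_bdR`: for the period-ring datum `B_dR(K)` (`bdRPeriodRingData`)
  choose finite models of `ρ₁`, `ρ₂` over a COMMON finite `E' ⊆ ℚ̄_ℓ` containing all `τ(K)` (accepted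
  `exists_intermediateField_ge_forall_fieldRange_le`, `HasQlModel.baseChange_inclusion`), admissible
  by model independence (accepted `IsDeRhamWith.isAdmissible_of_hasQlModel`), read the three weight
  multisets on the models (accepted `labelledHodgeTateWeights_eq_of_hasQlModel`), feed Wach's filtered
  comparison for the two models (accepted `exists_basis_mem_filTensor_iff_of_isDeRham`) into the
  abstract theorem `PeriodRingData.labelledHodgeTateWeights_kron` (`LabelledWeightsKronecker`).
* THE pinned datum has period ring `B_dR(K)` (accepted `fontainePst_𝔅_eq_bdRPeriodRingData`) and
  `K/ℚ_ℓ` finite for its `ℚ_ℓ`-structure (accepted `fontainePst_finiteDimensional`).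

## References
* [FontaineAsterisque223III] J.-M. Fontaine, Astérisque 223 (1994), Exp. III §1.5, Prop. 1.5.2,
  Thm. 1.5.2.
* [BrinonConrad2009] O. Brinon, B. Conrad, *CMI Summer School notes on p-adic Hodge theory* (2009),
  §6.3.
* [Patrikis2019] S. Patrikis, *Variations on a theorem of Tate*, Mem. AMS 258 (2019), §2.3.1, §2.7.1.
* [BuzzardGeeLMS2014] K. Buzzard, T. Gee, *The conjectural connections between automorphic
  representations and Galois representations* (2014), §2.2.
* [Lang1965Algebra] S. Lang, *Algebra*, Ch. XVI §2.
-/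

noncomputable section

open scoped TensorProduct Kronecker
open Field ValuativeRel
open Literature.NumberTheory.GaloisRepresentations
open Literature.NumberTheory.Automorphic

/-! ### Kronecker products of invertible matrices, framed representations and models -/

namespace Literature.NumberTheory.GaloisRepresentations

/-- `e_*(A ⊗ₖ B) · e_*(A' ⊗ₖ B') = e_*(AA' ⊗ₖ BB')` (Mathlib `Matrix.mul_kronecker_mul`, transported
along the enumeration `e`). [cite: Lang1965Algebra, Ch. XVI §2] -/
theorem reindex_kronecker_mul_reindex_kronecker {A : Type*} [CommRing A] {n m k : ℕ}
    (e : Fin n × Fin m ≃ Fin k) (M M' : Matrix (Fin n) (Fin n) A) (N N' : Matrix (Fin m) (Fin m) A) :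
    Matrix.reindex e e (M ⊗ₖ N) * Matrix.reindex e e (M' ⊗ₖ N') =
      Matrix.reindex e e ((M * M') ⊗ₖ (N * N')) := by
  rw [Matrix.reindex_apply, Matrix.reindex_apply, Matrix.reindex_apply, Matrix.submatrix_mul_equiv,
    ← Matrix.mul_kronecker_mul]

/-- **The Kronecker product of invertible matrices is invertible**, with inverse the Kronecker
product of the inverses (in the enumeration `e`). [cite: Lang1965Algebra, Ch. XVI §2] -/
theorem exists_generalLinearGroup_kron {A : Type*} [CommRing A] {n m k : ℕ}
    (e : Fin n × Fin m ≃ Fin k) (u₁ : GL (Fin n) A) (u₂ : GL (Fin m) A) :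
    ∃ u : GL (Fin k) A, (u : Matrix (Fin k) (Fin k) A) = Matrix.reindex e e (u₁.val ⊗ₖ u₂.val) ∧
      ((u⁻¹ : GL (Fin k) A) : Matrix (Fin k) (Fin k) A) =
        Matrix.reindex e e ((u₁⁻¹ : GL (Fin n) A).val ⊗ₖ (u₂⁻¹ : GL (Fin m) A).val) := by
  refine ⟨⟨Matrix.reindex e e (u₁.val ⊗ₖ u₂.val),
    Matrix.reindex e e ((u₁⁻¹ : GL (Fin n) A).val ⊗ₖ (u₂⁻¹ : GL (Fin m) A).val), ?_, ?_⟩, rfl, rfl⟩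
  · rw [reindex_kronecker_mul_reindex_kronecker, Units.mul_inv, Units.mul_inv,
      Matrix.one_kronecker_one, Matrix.reindex_apply, Matrix.submatrix_one_equiv]
  · rw [reindex_kronecker_mul_reindex_kronecker, Units.inv_mul, Units.inv_mul,
      Matrix.one_kronecker_one, Matrix.reindex_apply, Matrix.submatrix_one_equiv]

namespace FramedRep

/-- **The Kronecker (tensor) product of two framed representations** `r₁ : G → GL_n(A)`,
`r₂ : G → GL_m(A)` in the product basis enumerated by `e : Fin n × Fin m ≃ Fin k` is a framed
representation `r : G →ₜ* GL_k(A)` with `r(σ) = e_*(r₁(σ) ⊗ₖ r₂(σ))`: multiplicativity is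
`Matrix.mul_kronecker_mul`, continuity (units topology) is entrywise.
[cite: Lang1965Algebra, Ch. XVI §2] [cite: BuzzardGeeLMS2014, §2.2] -/
theorem exists_kron {G : Type*} [Group G] [TopologicalSpace G] {A : Type*} [CommRing A]
    [TopologicalSpace A] [IsTopologicalRing A] {n m k : ℕ} (e : Fin n × Fin m ≃ Fin k)
    (r₁ : FramedRep G A n) (r₂ : FramedRep G A m) :
    ∃ r : FramedRep G A k, ∀ σ, (r σ).val = Matrix.reindex e e ((r₁ σ).val ⊗ₖ (r₂ σ).val) := by
  classical
  choose u hu huinv using fun σ : G => exists_generalLinearGroup_kron e (r₁ σ) (r₂ σ)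
  have humul : ∀ a b, u (a * b) = u a * u b := fun a b => Units.ext <| by
    rw [Units.val_mul, hu, hu, hu, map_mul, map_mul, Units.val_mul, Units.val_mul,
      reindex_kronecker_mul_reindex_kronecker]
  let f : G →* GL (Fin k) A := MonoidHom.mk' u humul
  have hA₁ : Continuous fun σ => ((r₁ σ : GL (Fin n) A) : Matrix (Fin n) (Fin n) A) :=
    Units.continuous_val.comp (map_continuous r₁)
  have hA₂ : Continuous fun σ => ((r₂ σ : GL (Fin m) A) : Matrix (Fin m) (Fin m) A) :=
    Units.continuous_val.comp (map_continuous r₂)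
  have hB₁ : Continuous fun σ => (((r₁ σ)⁻¹ : GL (Fin n) A) : Matrix (Fin n) (Fin n) A) :=
    Units.continuous_coe_inv.comp (map_continuous r₁)
  have hB₂ : Continuous fun σ => (((r₂ σ)⁻¹ : GL (Fin m) A) : Matrix (Fin m) (Fin m) A) :=
    Units.continuous_coe_inv.comp (map_continuous r₂)
  have hf : Continuous f := by
    refine Units.continuous_iff.2 ⟨?_, ?_⟩
    · have : (Units.val ∘ f) = fun σ => Matrix.reindex e e ((r₁ σ).val ⊗ₖ (r₂ σ).val) :=
        funext fun σ => hu σ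
      rw [this]
      refine continuous_matrix fun i j => ?_
      simp only [Matrix.reindex_apply, Matrix.submatrix_apply, Matrix.kroneckerMap_apply]
      exact (hA₁.matrix_elem _ _).mul (hA₂.matrix_elem _ _)
    · have : (fun σ => (((f σ)⁻¹ : GL (Fin k) A) : Matrix (Fin k) (Fin k) A)) = fun σ =>
          Matrix.reindex e e ((((r₁ σ)⁻¹ : GL (Fin n) A)).val ⊗ₖ (((r₂ σ)⁻¹ : GL (Fin m) A)).val) :=
        funext fun σ => huinv σ
      rw [this]
      refine continuous_matrix fun i j => ?_
      simp only [Matrix.reindex_apply, Matrix.submatrix_apply, Matrix.kroneckerMap_apply]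
      exact (hB₁.matrix_elem _ _).mul (hB₂.matrix_elem _ _)
  exact ⟨{ f with continuous_toFun := hf }, fun σ => hu σ⟩

end FramedRep

/-- **Kronecker products of models are models of the Kronecker product**: if `ρᵢ = Pᵢ (rEᵢ ⊗_E ℚ̄_ℓ) Pᵢ⁻¹`
(`i = 1, 2`) and `rE`, `ρ` are the Kronecker products in the enumeration `e`, then
`ρ = P (rE ⊗_E ℚ̄_ℓ) P⁻¹` with `P = e_*(P₁ ⊗ₖ P₂)`.  Deliberate dot-notation extension of the accepted
`Literature.NumberTheory.Automorphic.HasQlModel`. [cite: BuzzardGeeLMS2014, §2.2] [cite: Lang1965Algebra, Ch. XVI §2] -/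
theorem _root_.Literature.NumberTheory.Automorphic.HasQlModel.kron
    {K : Type} [Field K] {ℓ : ℕ} [Fact ℓ.Prime] {n m k : ℕ} (e : Fin n × Fin m ≃ Fin k)
    {ρ₁ : FramedRep (absoluteGaloisGroup K) (PadicAlgCl ℓ) n}
    {ρ₂ : FramedRep (absoluteGaloisGroup K) (PadicAlgCl ℓ) m}
    {ρ : FramedRep (absoluteGaloisGroup K) (PadicAlgCl ℓ) k}
    (hkron : ∀ σ, (ρ σ).val = Matrix.reindex e e ((ρ₁ σ).val ⊗ₖ (ρ₂ σ).val))
    {E : IntermediateField ℚ_[ℓ] (PadicAlgCl ℓ)} {rE₁ : FramedRep (absoluteGaloisGroup K) E n}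
    {rE₂ : FramedRep (absoluteGaloisGroup K) E m} {rE : FramedRep (absoluteGaloisGroup K) E k}
    (hkronE : ∀ σ, (rE σ).val = Matrix.reindex e e ((rE₁ σ).val ⊗ₖ (rE₂ σ).val))
    (h₁ : HasQlModel ρ₁ E rE₁) (h₂ : HasQlModel ρ₂ E rE₂) : HasQlModel ρ E rE := by
  obtain ⟨P₁, hP₁⟩ := h₁
  obtain ⟨P₂, hP₂⟩ := h₂
  obtain ⟨P, hP, hPinv⟩ := exists_generalLinearGroup_kron e P₁ P₂
  refine ⟨P, ContinuousMonoidHom.ext fun σ => Units.ext ?_⟩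
  have hρ₁ := congrArg (fun r : FramedRep (absoluteGaloisGroup K) (PadicAlgCl ℓ) n =>
    ((r σ : GL (Fin n) (PadicAlgCl ℓ)) : Matrix (Fin n) (Fin n) (PadicAlgCl ℓ))) hP₁
  have hρ₂ := congrArg (fun r : FramedRep (absoluteGaloisGroup K) (PadicAlgCl ℓ) m =>
    ((r σ : GL (Fin m) (PadicAlgCl ℓ)) : Matrix (Fin m) (Fin m) (PadicAlgCl ℓ))) hP₂
  simp only [FramedRep.conj_apply, Units.val_mul, FramedRep.coe_baseChange_apply] at hρ₁ hρ₂
  have hmap : (Matrix.reindex e e ((rE₁ σ).val ⊗ₖ (rE₂ σ).val)).map (algebraMap E (PadicAlgCl ℓ)) =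
      Matrix.reindex e e (((rE₁ σ).val.map (algebraMap E (PadicAlgCl ℓ))) ⊗ₖ
        ((rE₂ σ).val.map (algebraMap E (PadicAlgCl ℓ)))) := by
    ext i j
    simp only [Matrix.map_apply, Matrix.reindex_apply, Matrix.submatrix_apply,
      Matrix.kroneckerMap_apply, map_mul]
  rw [FramedRep.conj_apply, Units.val_mul, Units.val_mul, FramedRep.coe_baseChange_apply, hP, hPinv,
    hkronE σ, hkron σ, hmap, reindex_kronecker_mul_reindex_kronecker,
    reindex_kronecker_mul_reindex_kronecker, hρ₁, hρ₂]

namespace PeriodRingData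

universe u v v' w w'

-- Mathlib's own global value of `maxSynthPendingDepth` (see `LabelledWeightsTwist`).
set_option maxSynthPendingDepth 3
set_option synthInstance.maxHeartbeats 200000

/-- **`D_τ(ρ)` is finite-dimensional over `E`** for `E/P`, `F/P` finite (Fontaine's inequality
`dim_F D(ρ) ≤ dim_P Eⁿ`, accepted `finrank_D_le_holds`, counted over `E`, accepted
`finite_coeffD_and_finrank_le`). [cite: FontaineAsterisque223III, Exp. III Prop. 1.4.2 and Thm. 1.5.2] -/
theorem finiteDimensional_labelD_pi {Γ : Type u} [Group Γ] [TopologicalSpace Γ] {P : Type v}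
    {F : Type v'} [Field P] [Field F] [Algebra P F] [TopologicalSpace P] {E : Type w} [Field E]
    [Algebra P E] [TopologicalSpace E] [IsTopologicalRing E] [FiniteDimensional P F]
    [FiniteDimensional P E] (𝔅 : PeriodRingData.{u, v, v', w'} Γ P F) {q : ℕ}
    (ρ : ContinuousRep Γ E (Fin q → E)) (τ : F →+* E) : FiniteDimensional E (𝔅.labelD ρ τ) := by
  haveI : Module.Finite F (𝔅.D (ρ.restrictScalars P)) :=
    Module.rank_lt_aleph0_iff.1 ((𝔅.rank_D_le _).trans_lt Cardinal.natCast_lt_aleph0)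
  have hD : Module.finrank F (𝔅.D (ρ.restrictScalars P)) ≤ Module.finrank P (Fin q → E) :=
    𝔅.finrank_D_le_holds _
  haveI := (𝔅.finite_coeffD_and_finrank_le ρ hD).1
  exact Submodule.finiteDimensional_of_le (𝔅.labelD_le_coeffD ρ _)

end PeriodRingData

end Literature.NumberTheory.GaloisRepresentations

namespace Literature.NumberTheory.PAdicHodge

-- Mathlib's own global value of `maxSynthPendingDepth` (see `LabelledWeightsTwist`); the tensor
-- types need a higher instance-synthesis budget.
set_option maxSynthPendingDepth 3
set_option synthInstance.maxHeartbeats 200000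

variable {K : Type} [Field K] [ValuativeRel K] [TopologicalSpace K] [IsNonarchimedeanLocalField K]
  [CharZero K] {ℓ : ℕ} [Fact ℓ.Prime]

/-- **`HT_τ(ρ₁ ⊗ ρ₂) = {a + b : a ∈ HT_τ(ρ₁), b ∈ HT_τ(ρ₂)}` for Fontaine's `B_dR(K)`** (any
`ℚ_ℓ`-structure on `K` with `K/ℚ_ℓ` finite; `𝔅 = bdRPeriodRingData hK`, stated through an equation so
as to apply to THE pinned datum) and de Rham framed `ρ₁`, `ρ₂` with Kronecker product `ρ` in the
enumeration `e`: read on finite admissible models over a common `E' ⊇ τ(K)`, where it is the abstract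
`PeriodRingData.labelledHodgeTateWeights_kron` fed with Wach's filtered comparison for `B_dR`.
[cite: FontaineAsterisque223III, Exp. III §1.5, Prop. 1.5.2 and Thm. 1.5.2] [cite: Patrikis2019, §2.3.1 and §2.7.1] [cite: BrinonConrad2009, §6.3] -/
theorem labelledHodgeTateWeights_kron_of_eq_bdR (hK : valuation K ℓ < 1) [Algebra ℚ_[ℓ] K]
    [FiniteDimensional ℚ_[ℓ] K] [Fact (¬ IsUnit ((ℓ : ℕ) : integerC K))]
    [IsAdicComplete (Ideal.span {((ℓ : ℕ) : integerC K)}) (integerC K)]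
    (𝔅 : PeriodRingData.{0, 0, 0, 0} (absoluteGaloisGroup K) ℚ_[ℓ] K)
    (h𝔅 : 𝔅 = bdRPeriodRingData (F := K) (p := ℓ) hK) {n m k : ℕ} (e : Fin n × Fin m ≃ Fin k)
    {ρ₁ : FramedRep (absoluteGaloisGroup K) (PadicAlgCl ℓ) n}
    {ρ₂ : FramedRep (absoluteGaloisGroup K) (PadicAlgCl ℓ) m}
    {ρ : FramedRep (absoluteGaloisGroup K) (PadicAlgCl ℓ) k}
    (hkron : ∀ σ, (ρ σ).val = Matrix.reindex e e ((ρ₁ σ).val ⊗ₖ (ρ₂ σ).val))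
    (hρ₁ : ρ₁.IsDeRhamWith ‹Algebra ℚ_[ℓ] K› 𝔅) (hρ₂ : ρ₂.IsDeRhamWith ‹Algebra ℚ_[ℓ] K› 𝔅)
    (τ : K →ₐ[ℚ_[ℓ]] PadicAlgCl ℓ) :
    𝔅.labelledHodgeTateWeights (FramedRep.toContinuousRep ρ) τ.toRingHom =
      (𝔅.labelledHodgeTateWeights (FramedRep.toContinuousRep ρ₁) τ.toRingHom).bind fun a =>
        (𝔅.labelledHodgeTateWeights (FramedRep.toContinuousRep ρ₂) τ.toRingHom).map
          fun b => a + b := by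
  classical
  have hB : IsField 𝔅.B := by
    haveI := isDomain_bDeRhamPlus (F := K) (p := ℓ) (surjective_fontaineTheta_integerC hK)
    rw [h𝔅]
    exact Field.toIsField (FracBdR K ℓ)
  -- finite models over a common `E'` containing all embeddings of `K`
  obtain ⟨E₁, hfin₁, rE₁, hmodel₁, -⟩ := id hρ₁
  obtain ⟨E₂, hfin₂, rE₂, hmodel₂, -⟩ := id hρ₂
  haveI : FiniteDimensional ℚ_[ℓ] E₁ := hfin₁
  haveI : FiniteDimensional ℚ_[ℓ] E₂ := hfin₂
  obtain ⟨E', hfin', hle, hE'⟩ := exists_intermediateField_ge_forall_fieldRange_le (K := K) (E₁ ⊔ E₂)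
  haveI : FiniteDimensional ℚ_[ℓ] E' := hfin'
  haveI : ContinuousSMul ℚ_[ℓ] E' := IntermediateField.continuousSMul_padicAlgCl E'
  have hsplit := card_algHom_eq_finrank_of_forall_fieldRange_le (K := K) E' hE'
  obtain ⟨rE₁', hmodel₁'⟩ : ∃ rE₁' : FramedRep (absoluteGaloisGroup K) E' n, HasQlModel ρ₁ E' rE₁' :=
    ⟨_, hmodel₁.baseChange_inclusion (le_sup_left.trans hle)⟩
  obtain ⟨rE₂', hmodel₂'⟩ : ∃ rE₂' : FramedRep (absoluteGaloisGroup K) E' m, HasQlModel ρ₂ E' rE₂' :=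
    ⟨_, hmodel₂.baseChange_inclusion (le_sup_right.trans hle)⟩
  -- their Kronecker product is a model of `ρ`
  obtain ⟨rE', hkronE⟩ := FramedRep.exists_kron e rE₁' rE₂'
  have hmodel' : HasQlModel ρ E' rE' := HasQlModel.kron e hkron hkronE hmodel₁' hmodel₂'
  -- the models of `ρ₁`, `ρ₂` are admissible (model independence of de Rham-ness)
  have hadm₁ : 𝔅.IsAdmissible ((FramedRep.toContinuousRep rE₁').restrictScalars ℚ_[ℓ]) :=
    hρ₁.isAdmissible_of_hasQlModel ‹Algebra ℚ_[ℓ] K› 𝔅 hmodel₁'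
  have hadm₂ : 𝔅.IsAdmissible ((FramedRep.toContinuousRep rE₂').restrictScalars ℚ_[ℓ]) :=
    hρ₂.isAdmissible_of_hasQlModel ‹Algebra ℚ_[ℓ] K› 𝔅 hmodel₂'
  -- Wach's filtered comparison for the two models
  have hcomp₁ : ∃ (d : ℕ) (𝒷 : Module.Basis (Fin d) 𝔅.B (𝔅.B ⊗[ℚ_[ℓ]] (Fin n → E')))
      (w : Fin d → ℤ),
      (∀ l, 𝒷 l ∈ 𝔅.D ((FramedRep.toContinuousRep rE₁').restrictScalars ℚ_[ℓ])) ∧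
      (∀ l, 𝒷 l ∈ 𝔅.filTensor (Fin n → E') (w l)) ∧
      ∀ (j : ℤ) (x : 𝔅.B ⊗[ℚ_[ℓ]] (Fin n → E')),
        x ∈ 𝔅.filTensor (Fin n → E') j ↔ ∀ l, 𝒷.repr x l ∈ 𝔅.fil (j - w l) := by
    subst h𝔅
    exact exists_basis_mem_filTensor_iff_of_isDeRham hK _ hadm₁
  have hcomp₂ : ∃ (d : ℕ) (𝒷 : Module.Basis (Fin d) 𝔅.B (𝔅.B ⊗[ℚ_[ℓ]] (Fin m → E')))
      (w : Fin d → ℤ),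
      (∀ l, 𝒷 l ∈ 𝔅.D ((FramedRep.toContinuousRep rE₂').restrictScalars ℚ_[ℓ])) ∧
      (∀ l, 𝒷 l ∈ 𝔅.filTensor (Fin m → E') (w l)) ∧
      ∀ (j : ℤ) (x : 𝔅.B ⊗[ℚ_[ℓ]] (Fin m → E')),
        x ∈ 𝔅.filTensor (Fin m → E') j ↔ ∀ l, 𝒷.repr x l ∈ 𝔅.fil (j - w l) := by
    subst h𝔅
    exact exists_basis_mem_filTensor_iff_of_isDeRham hK _ hadm₂
  -- the embedding `τ` factors through `E'`
  let τ₀ : K →ₐ[ℚ_[ℓ]] E' := (IntermediateField.inclusion (hE' τ)).comp τ.equivFieldRange.toAlgHom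
  have hτ : τ.toRingHom = (PeriodRingData.extEmb (E := PadicAlgCl ℓ) τ₀).toRingHom :=
    RingHom.ext fun x => rfl
  -- the abstract theorem on the models
  have hkr := PeriodRingData.labelledHodgeTateWeights_kron 𝔅 hB hsplit e rE₁' rE₂' rE' hkronE
    hadm₁ hadm₂ hcomp₁ hcomp₂ τ₀
  haveI := 𝔅.finiteDimensional_labelD_pi (FramedRep.toContinuousRep rE') τ₀.toRingHom
  haveI := 𝔅.finiteDimensional_labelD_pi (FramedRep.toContinuousRep rE₁') τ₀.toRingHom
  haveI := 𝔅.finiteDimensional_labelD_pi (FramedRep.toContinuousRep rE₂') τ₀.toRingHom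
  rw [FramedRep.labelledHodgeTateWeights_eq_of_hasQlModel 𝔅 hmodel' hsplit τ τ₀ hτ,
    FramedRep.labelledHodgeTateWeights_eq_of_hasQlModel 𝔅 hmodel₁' hsplit τ τ₀ hτ,
    FramedRep.labelledHodgeTateWeights_eq_of_hasQlModel 𝔅 hmodel₂' hsplit τ τ₀ hτ, hkr]

/-- **`KroneckerLabelledWeightsSchema` holds** (`FontainePstKroneckerSchemata`): for THE pinned datum
`fontainePst K ℓ hK` (period ring `B_dR(K)`, accepted `fontainePst_𝔅_eq_bdRPeriodRingData`; `K/ℚ_ℓ`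
finite, accepted `fontainePst_finiteDimensional`), de Rham `ρ₁ : Γ_K → GL_n(ℚ̄_ℓ)`,
`ρ₂ : Γ_K → GL_m(ℚ̄_ℓ)`, their Kronecker product `ρ` in the enumeration `e`, and a label
`τ : K → ℚ̄_ℓ`: `HT_τ(ρ) = {a + b : a ∈ HT_τ(ρ₁), b ∈ HT_τ(ρ₂)}` with multiplicities.
[cite: FontaineAsterisque223III, Exp. III §1.5, Prop. 1.5.2] [cite: BrinonConrad2009, §6.3]
[cite: Patrikis2019, §2.3.1] -/
theorem KroneckerLabelledWeightsSchema_holds : KroneckerLabelledWeightsSchema := by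
  intro ℓ _ K _ _ _ _ _ hK n m k e ρ₁ ρ₂ ρ hkron hρ₁ hρ₂
  letI := (fontainePst K ℓ hK).algebra
  intro τ
  haveI : Fact (¬ IsUnit ((ℓ : ℕ) : integerC K)) := ⟨not_isUnit_natCast_integerC hK⟩
  haveI : IsAdicComplete (Ideal.span {((ℓ : ℕ) : integerC K)}) (integerC K) :=
    isAdicComplete_integerC_natCast hK
  haveI : FiniteDimensional ℚ_[ℓ] K := fontainePst_finiteDimensional hK
  exact labelledHodgeTateWeights_kron_of_eq_bdR hK _ (fontainePst_𝔅_eq_bdRPeriodRingData hK) e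
    hkron hρ₁ hρ₂ τ

end Literature.NumberTheory.PAdicHodge

end
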